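import Summits.NavierStokesRegularity.NavierStokesRegularity.Theses.TypeILiouville
import Summits.NavierStokesRegularity.NavierStokesRegularity.Theorems.TypeILiouvilleTypeIliouvilleNoTypeIIGradientPivot
import Summits.NavierStokesRegularity.NavierStokesRegularity.Theorems.TypeILiouvilleTypeIliouvilleNoTypeIIGradientPivotFastBalls
import HarnessLib

/-!
# `TypeIliouvilleNoTypeII` (stmt-NavierStokesRegularity-0056) — line `Sketch` of passes c1/c2
# (= idea `gradient-bkm-pivot`, ideator 1), lead skeleton, revision 4 (pass c2; adopted unchanged by pass c3)

The crux (`NoTypeII`, shared by 15 routes): a maximal smooth solution of Navier–Stokes on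
`ℝ³ × [0, T)`, `0 < T < ∞`, which is Leray–Hopf from a rapidly decaying datum blows up at the
Type I rate `‖u(t)‖_∞ ≤ C (T - t)^{-1/2}`.

Line (pivot at the GRADIENT rate).  Everything provable of revisions 1–3 has LANDED and is
imported from the tree (pass c1):

1. `stub_gradientSharp_of_typeI` — LANDED p139164: Type-I velocity ⇒ `‖∇u(t)‖_∞ ≤ C/(T - t)`.
2. `stub_threeFifthsLaw` — LANDED p139256: `‖v‖_∞ ≤ C ‖v‖₂^{2/5} ‖∇v‖_∞^{3/5}`.
3. `stub_energyBound` — LANDED p139029: `‖u(t)‖₂ ≤ ‖u(0)‖₂` on `[0, T]`.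
6. `stub_threeFifthsLawCurl` — LANDED p139422: `‖v‖_∞ ≤ C ‖v‖₂^{2/5} ‖curl v‖_∞^{3/5}`.
*  glue — LANDED p139883 (`…GradientPivot`: `velocityThreeFifths`, `gradientSharp_of_noTypeII`,
   **NoTypeII ⇔ A ∧ B**, **NoTypeII ⇔ A ∧ WindowActivity(v2)**) and p140218
   (`…GradientPivotVorticity`: **NoTypeII ⇔ A′ ∧ B′**, vorticity form).

Revision 4 (pass c2) RESHAPES the fine-structure residual B (`stub_windowTypeI`: gradient-sharp
and `(T - t)^{-3/5}`-bounded ⇒ Type I) into its open core and a provable shell, following the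
card's §Why-it-bites (3) ("under GradientBKMSharp a Type-II peak is a FAT BOOST BLOB: velocity
≈ const on a ball of radius ≫ √(T - t)"):

4. `stub_gradientBKMSharp` — RESIDUAL A (OPEN, unchanged): every maximal Leray–Hopf solution from
   a rapidly decaying datum has `‖∇u(t)‖_∞ ≤ C/(T - t)` eventually.
5. `stub_noFastBalls` — RESIDUAL B1 (OPEN): under gradient sharpness, eventually EVERY ball of
   parabolic radius `√(T - t)` contains a point of Type-I speed,
   `∃ K, ∀ᶠ t, ∀ x, ∃ y ∈ B(x, √(T - t)), ‖u t y‖ ≤ K/√(T - t)` — the typed negation of the fat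
   boost blob.  Trivially necessary for the crux (`y = x`); implied by a uniform Type-I bound on
   Seregin's scaled local energy `(T - t)^{-1/2} ∫_{B(x, √(T-t))} ‖u(t)‖²` and by a Type-I bound
   on parabolic ball averages of `‖u(t)‖` (dictionary file of this pass), so it is the weakest
   surface form of the fine-structure half; under A it is equivalent to the crux.
7. `stub_typeI_of_noFastBalls` — LANDED p141056 (`…GradientPivotFastBalls`, mean-value
   inequality on the convex ball `B(x, √(T - t))`): gradient sharpness and B1 give
   `‖u t x‖ ≤ ‖u t y‖ + √(T - t) · C₁/(T - t) ≤ (K + C₁)/√(T - t)`, i.e. `IsTypeIBlowup u T`;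
   the same file lands the dictionary **NoTypeII ⇔ A ∧ B1**
   (`TypeIliouvilleNoTypeII_iff_gradientSharp_and_noFastBalls`) and the discharges of B1 by
   scaled-energy Type I (`noFastBalls_of_scaledEnergy`, Seregin's centre-free `A`-quantity) and
   by ball-integral Type I (`noFastBalls_of_ballIntegral`).

Composition: `TypeIliouvilleNoTypeII_of` = STUB 4 → STUB 5 → STUB 7 (the 3/5 law is no longer on
the path; it stays in the tree as the quantitative dictionary `velocityThreeFifths`).
-/

noncomputable section

-- the summit and its single problem share the name `NavierStokesRegularity` (D-0017 nested layout)
set_option linter.dupNamespace false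

open Set Function Filter Topology MeasureTheory Metric
open scoped NNReal ENNReal

namespace Summit.NavierStokesRegularity.NavierStokesRegularity.Theorems.TypeIliouvilleNoTypeII.GradientPivot

open Literature.Analysis Literature.Analysis.FluidPDE

/-- `ℝ³`. -/
local notation "E3" => EuclideanSpace ℝ (Fin 3)

/-! ## Residual stubs (the open mathematics of the crux, split at the gradient rate) -/

/-- STUB 4 — RESIDUAL A, OPEN (`GradientBKMSharp`).  Every maximal smooth solution with finite
lifespan `T` which is Leray–Hopf from a rapidly decaying datum has a BKM-sharp gradient:
`‖∇u(t)‖_∞ ≤ C/(T - t)` for `t < T` near `T`.  NECESSARY for the crux (`gradientSharp_of_noTypeII`,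
landed); Beale–Kato–Majda gives only the floor `∫ ‖curl u‖_∞ = ∞`; satisfied by Tao's averaged
Type-II blow-up (arXiv:1402.0290 Prop. 6.3 (6.11)–(6.12)), violated at most logarithmically in
Hou's scenario (arXiv:2107.06509 §3.4). -/
theorem stub_gradientBKMSharp (ν T : ℝ) (hν : 0 < ν) (hT : 0 < T) (u : ℝ → E3 → E3)
    (p : ℝ → E3 → ℝ) (hmax : IsMaximalSmoothSolution ν 0 u p T)
    (hLH : IsLerayHopfOn T ν 0 (u 0) u) (hdec : HasRapidSpatialDecay (u 0)) :
    ∃ C : ℝ, ∀ᶠ t in 𝓝[<] T, ∀ x, ‖fderiv ℝ (u t) x‖ ≤ C / (T - t) := by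
  sorry

/-- STUB 5 — RESIDUAL B1, OPEN (`NoFastBalls`).  A maximal smooth solution with finite lifespan
`T`, Leray–Hopf from a rapidly decaying datum, whose gradient is BKM-sharp
(`‖∇u(t)‖_∞ ≤ C₁/(T - t)` near `T`) has NO FAST PARABOLIC BALLS near `T`: there is `K` such that
for all `t < T` near `T` every ball `B(x, √(T - t))` contains a point `y` with
`‖u(t, y)‖ ≤ K/√(T - t)`.  Trivially necessary for the crux (`y = x`); the open content is the
exclusion of the card's "fat boost blob" (a ball of radius `≥ √(T - t)` moving uniformly at a
Type-II speed), i.e. the finite-energy Euler window of velocity exponents `[1/2, 3/5]`; Tao's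
averaged blow-up HAS such blobs, so only fine-structure arguments can prove it.  Implied by a
uniform Type-I bound on the scaled local energies `(T - t)^{-1/2} ∫_{B(x,√(T - t))} ‖u(t)‖²`
(Seregin's `A`-quantity, uniformly in the centre). -/
theorem stub_noFastBalls (ν T : ℝ) (hν : 0 < ν) (hT : 0 < T) (u : ℝ → E3 → E3)
    (p : ℝ → E3 → ℝ) (hmax : IsMaximalSmoothSolution ν 0 u p T)
    (hLH : IsLerayHopfOn T ν 0 (u 0) u) (hdec : HasRapidSpatialDecay (u 0))
    (hG : ∃ C₁ : ℝ, ∀ᶠ t in 𝓝[<] T, ∀ x, ‖fderiv ℝ (u t) x‖ ≤ C₁ / (T - t)) :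
    ∃ K : ℝ, ∀ᶠ t in 𝓝[<] T, ∀ x : E3, ∃ y ∈ ball x (Real.sqrt (T - t)),
      ‖u t y‖ ≤ K / Real.sqrt (T - t) := by
  sorry

/-! ## Composition -/

/-- **The crux from the stubs** (`TypeIliouvilleNoTypeII`, concluded BY NAME): residual A
(STUB 4) gives the sharp gradient, residual B1 (STUB 5) excludes fast parabolic balls, and the
landed STUB 7 (`stub_typeI_of_noFastBalls`, p141056) turns the two into the Type I rate. -/
theorem TypeIliouvilleNoTypeII_of :
    Summit.NavierStokesRegularity.NavierStokesRegularity.Theses.TypeILiouville.TypeIliouvilleNoTypeII := by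
  intro ν T hν hT u p hmax hLH hdec
  have hG := stub_gradientBKMSharp ν T hν hT u p hmax hLH hdec
  exact stub_typeI_of_noFastBalls ν T hT u p hmax.1 hG
    (stub_noFastBalls ν T hν hT u p hmax hLH hdec hG)

end Summit.NavierStokesRegularity.NavierStokesRegularity.Theorems.TypeIliouvilleNoTypeII.GradientPivot

end
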